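import Literature.Probability.RandomPlanarGeometry.CurveTortuosity
import HarnessLib

/-!
# Crux `NestingRigidity`, line `pinch-resampling` (v3), stub S9 helper: cellwise matching of two curves

Crux `Summit.CriticalPhenomena.CardyFormulaZ2.Theses.CardyMagicRigidity.NestingRigidity`
(stmt-CriticalPhenomena-4835), line `pinch-resampling` v3, stub S9 `stub_noNeckRigidity` (no-neck rigidity of
planar arcs).  This file is the lattice-free MATCHING brick of the proof of `NoNeckRigidity`: a bound on the
oriented reparametrisation distance `Curve.reparamDist a b` from a MONOTONE (not necessarily continuous, not
necessarily strictly increasing) corridor map `g : [0,1] → [0,1]` with `g 0 = 0`, `g 1 = 1` such that on every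
short time cell `[τ₁, τ₂]` (length `< δ`) the whole `a`-arc `a[g τ₁, g τ₂]` is within `C` of the whole `b`-arc
`b[τ₁, τ₂]`.  Then `reparamDist a b ≤ C` (`reparamDist_le_of_monotone_cells`, registered anchor).

Proof: for `η > 0` take a uniform grid `u_i = i/N` of mesh `< δ`, the corridor values `v_i = g u_i` (weakly
increasing, `v_0 = 0`, `v_N = 1`) and their strictly increasing perturbation `w_i = (1 - κ) v_i + κ u_i`
(`0 < κ < 1` smaller than a modulus of uniform continuity of `a` for `η`); the order automorphism `φ` of `[0,1]`
with `φ w_i = u_i` (`exists_orderIso_unitInterval_apply_eq`) matches `x ∈ [w_i, w_{i+1}]` with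
`φ x ∈ [u_i, u_{i+1}]`, and `x` is within `κ` of a point `s ∈ [v_i, v_{i+1}]`, whence
`dist (a x) (b (φ x)) ≤ η + C`.
-/

noncomputable section

namespace Summit.CriticalPhenomena.CardyFormulaZ2.Cruxes.NestingRigidity.PinchResampling

open Set Literature.Probability.RandomPlanarGeometry

/-- **Cellwise matching bound for the reparametrisation distance** (registered helper of stub S9).  If
`g : [0,1] → [0,1]` is monotone with `g 0 = 0`, `g 1 = 1`, and for all times `τ₁ < τ₂` with `τ₂ - τ₁ < δ`
every point of the `a`-arc over `[g τ₁, g τ₂]` is within `C` of every point of the `b`-arc over `[τ₁, τ₂]`,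
then `Curve.reparamDist a b ≤ C`. -/
theorem reparamDist_le_of_monotone_cells : ∀ (a b : Curve ℂ) (C δ : ℝ) (g : unitInterval → unitInterval), 0 < δ → Monotone g → g 0 = 0 → g 1 = 1 → (∀ τ₁ τ₂ : unitInterval, τ₁ < τ₂ → (τ₂ : ℝ) - τ₁ < δ → ∀ s ∈ Set.Icc (g τ₁) (g τ₂), ∀ τ ∈ Set.Icc τ₁ τ₂, dist (a s) (b τ) ≤ C) → Curve.reparamDist a b ≤ C := by
  intro a b C δ g hδ hg hg0 hg1 hcell
  refine le_of_forall_pos_le_add fun η hη ↦ ?_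
  -- uniform continuity of `a`
  obtain ⟨κ₀, hκ₀, hκa⟩ := Metric.uniformContinuous_iff.1
    (CompactSpace.uniformContinuous_of_continuous a.continuous) η hη
  -- grid size `N` with `1 / N < δ`
  obtain ⟨N, hN⟩ := exists_nat_gt (1 / δ)
  have hNpos : 0 < (N : ℝ) := lt_trans (by positivity) hN
  have hNnat : 0 < N := by exact_mod_cast hNpos
  have hN1 : 1 / (N : ℝ) < δ := by
    rw [div_lt_iff₀ hNpos]
    have := (div_lt_iff₀ hδ).1 hN
    linarith
  -- perturbation parameter
  set κ : ℝ := min (1 / 2) (κ₀ / 2) with hκ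
  have hκpos : 0 < κ := by positivity
  have hκ1 : κ < 1 := (min_le_left _ _).trans_lt (by norm_num)
  have hκκ₀ : κ < κ₀ := (min_le_right _ _).trans_lt (by linarith)
  -- the uniform grid `u`, the corridor values `v`, the perturbed values `w`
  let u : Fin (N + 1) → unitInterval := fun i ↦ ⟨(i : ℝ) / N, div_nonneg (Nat.cast_nonneg _) hNpos.le,
    (div_le_one hNpos).2 (by exact_mod_cast Nat.lt_succ_iff.1 i.is_lt)⟩
  have hu_coe : ∀ i, (u i : ℝ) = (i : ℝ) / N := fun i ↦ rfl
  let v : Fin (N + 1) → unitInterval := fun i ↦ g (u i)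
  let w : Fin (N + 1) → unitInterval := fun i ↦ ⟨(1 - κ) * (v i : ℝ) + κ * (u i : ℝ), by
    constructor
    · have h1 := (v i).2.1; have h2 := (u i).2.1
      positivity
    · have h1 := (v i).2.2; have h2 := (u i).2.2
      nlinarith⟩
  have hw_coe : ∀ i, (w i : ℝ) = (1 - κ) * (v i : ℝ) + κ * (u i : ℝ) := fun i ↦ rfl
  have hu : StrictMono u := fun i j hij ↦ by
    show (i : ℝ) / N < j / N
    exact div_lt_div_of_pos_right (by exact_mod_cast hij) hNpos
  have hv : Monotone v := fun i j hij ↦ hg (hu.monotone hij)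
  have hw : StrictMono w := fun i j hij ↦ by
    show (1 - κ) * (v i : ℝ) + κ * (u i : ℝ) < (1 - κ) * (v j : ℝ) + κ * (u j : ℝ)
    have h1 : (v i : ℝ) ≤ v j := Subtype.coe_le_coe.2 (hv hij.le)
    have h2 : (u i : ℝ) < u j := hu hij
    nlinarith
  have hu0 : u 0 = 0 := Subtype.ext (by simp [hu_coe])
  have huN : u (Fin.last N) = 1 := Subtype.ext (by
    rw [hu_coe, Fin.val_last]; exact div_self hNpos.ne')
  have hv0 : v 0 = 0 := by show g (u 0) = 0; rw [hu0, hg0]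
  have hvN : v (Fin.last N) = 1 := by show g (u (Fin.last N)) = 1; rw [huN, hg1]
  have hw0 : w 0 = 0 := Subtype.ext (by
    rw [hw_coe, hv0, hu0]; simp)
  have hwN : w (Fin.last N) = 1 := Subtype.ext (by
    rw [hw_coe, hvN, huN]; simp)
  obtain ⟨φ, hφ⟩ := exists_orderIso_unitInterval_apply_eq w u hw hu ⟨0, hw0⟩ ⟨Fin.last N, hwN⟩
    ⟨0, hu0⟩ ⟨Fin.last N, huN⟩
  -- the bound along `φ`
  refine (Curve.reparamDist_le a b φ).trans ?_
  rw [ContinuousMap.dist_le_iff_of_nonempty]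
  intro x
  change dist (a x) (b (φ x)) ≤ C + η
  classical
  -- the last node `w i₀ ≤ x`
  set A : Finset (Fin (N + 1)) := Finset.univ.filter (fun i ↦ w i ≤ x) with hA
  have hAne : A.Nonempty := ⟨0, Finset.mem_filter.2 ⟨Finset.mem_univ _, by rw [hw0]; exact bot_le⟩⟩
  set i₀ : Fin (N + 1) := A.max' hAne with hi₀
  have hi₀A : i₀ ∈ A := A.max'_mem hAne
  have hi₀x : w i₀ ≤ x := (Finset.mem_filter.1 hi₀A).2
  by_cases hlast : i₀ = Fin.last N
  · -- then `x = 1` and `φ x = 1`: use the last cell directly at `s = 1`, `τ = 1`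
    have hx1 : x = 1 := le_antisymm le_top (by rw [← hwN, ← hlast]; exact hi₀x)
    have hφ1 : φ x = 1 := by
      have h := hφ (Fin.last N)
      rw [hwN, huN] at h
      rw [hx1, h]
    rw [hφ1, hx1]
    -- the last cell `[u (N-1), u N]`
    obtain ⟨M, rfl⟩ : ∃ M, N = M + 1 := ⟨N - 1, by omega⟩
    have hlt : (Fin.castSucc (Fin.last M) : Fin (M + 1 + 1)) < Fin.last (M + 1) :=
      Fin.castSucc_lt_last _
    have hcell' := hcell (u (Fin.castSucc (Fin.last M))) (u (Fin.last (M + 1))) (hu hlt) (by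
      rw [hu_coe, hu_coe, Fin.val_last, Fin.val_castSucc, Fin.val_last, ← sub_div]
      push_cast
      rw [show ((M : ℝ) + 1 - M) = 1 by ring]
      exact_mod_cast hN1) 1 ⟨by rw [← hg1]; exact hg le_top, by rw [huN, hg1]⟩ 1 ⟨le_top, by rw [huN]⟩
    linarith
  · -- the next node `w i₁ > x`
    have hi₀N : (i₀ : ℕ) < N := by
      have h1 : (i₀ : ℕ) ≤ N := Nat.lt_succ_iff.1 i₀.is_lt
      refine lt_of_le_of_ne h1 fun h ↦ hlast (Fin.ext ?_)
      rw [h, Fin.val_last]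
    set i₁ : Fin (N + 1) := ⟨i₀ + 1, by omega⟩ with hi₁
    have hi₀i₁ : i₀ < i₁ := Fin.lt_def.2 (by simp [hi₁])
    have hxi₁ : x < w i₁ := by
      by_contra hle
      have hmem : i₁ ∈ A := Finset.mem_filter.2 ⟨Finset.mem_univ _, not_lt.1 hle⟩
      exact absurd (A.le_max' i₁ hmem) (not_le.2 hi₀i₁)
    -- `φ x ∈ [u i₀, u i₁]`
    have hφx : φ x ∈ Icc (u i₀) (u i₁) := by
      constructor
      · rw [← hφ i₀]; exact φ.monotone hi₀x
      · rw [← hφ i₁]; exact φ.monotone hxi₁.le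
    -- a point `s ∈ [v i₀, v i₁]` within `κ` of `x`
    have hvv : v i₀ ≤ v i₁ := hv hi₀i₁.le
    obtain ⟨s, hs, hxs⟩ : ∃ s ∈ Icc (v i₀) (v i₁), dist x s ≤ κ := by
      rcases lt_or_ge x (v i₀) with h₁ | h₁
      · refine ⟨v i₀, ⟨le_rfl, hvv⟩, ?_⟩
        rw [Subtype.dist_eq, Real.dist_eq, abs_sub_comm, abs_of_pos (sub_pos.2 (Subtype.coe_lt_coe.2 h₁))]
        have h₂ : (w i₀ : ℝ) ≤ x := Subtype.coe_le_coe.2 hi₀x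
        rw [hw_coe] at h₂
        have h₃ := (v i₀).2.2
        have h₄ := (u i₀).2.1
        nlinarith
      rcases lt_or_ge (v i₁) x with h₂ | h₂
      · refine ⟨v i₁, ⟨hvv, le_rfl⟩, ?_⟩
        rw [Subtype.dist_eq, Real.dist_eq, abs_of_pos (sub_pos.2 (Subtype.coe_lt_coe.2 h₂))]
        have h₃ : (x : ℝ) ≤ w i₁ := Subtype.coe_le_coe.2 hxi₁.le
        rw [hw_coe] at h₃
        have h₄ := (v i₁).2.1
        have h₅ := (u i₁).2.2
        nlinarith
      · exact ⟨x, ⟨h₁, h₂⟩, by rw [dist_self]; exact hκpos.le⟩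
    -- conclude
    have hcell' := hcell (u i₀) (u i₁) (hu hi₀i₁) (by
      rw [hu_coe, hu_coe, ← sub_div]
      simp only [hi₁]
      push_cast
      rw [show ((i₀ : ℝ) + 1 - i₀) = 1 by ring]
      exact hN1) s hs (φ x) hφx
    have hax : dist (a x) (a s) < η := hκa (hxs.trans_lt hκκ₀)
    calc dist (a x) (b (φ x)) ≤ dist (a x) (a s) + dist (a s) (b (φ x)) := dist_triangle _ _ _
      _ ≤ η + C := by linarith [hax.le]
      _ = C + η := add_comm _ _

end Summit.CriticalPhenomena.CardyFormulaZ2.Cruxes.NestingRigidity.PinchResampling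

end
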